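import Literature.Geometry.Symplectic.PlusOneSpherePair
import Literature.Topology.FourManifolds.ComplexProjectiveSpaceProofs
import Mathlib.Geometry.Manifold.ContMDiff.Atlas
import Mathlib.Geometry.Manifold.ContMDiff.NormedSpace
import Mathlib.Geometry.Manifold.Diffeomorph
import Mathlib.LinearAlgebra.FiniteDimensional.Basic
import Mathlib.Topology.Algebra.Module.FiniteDimension
import HarnessLib

/-!
# Projective transformations of the tree's `ℂℙⁿ` and the choice of line in
`mcduff_plusOneSphere_pairDiffeomorph`

Sibling proof file of `PlusOneSpherePair.lean` (named fact
`Literature.Geometry.Symplectic.mcduff_plusOneSphere_pairDiffeomorph`; McDuff 1990, Thm. 1.4 with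
Cor. 1.5 (i); Wendl 2018, Thm. D (2) = Thm. 6.9 (2)). The printed conclusion is a diffeomorphism
of pairs `(N, b(S)) ≅ (ℂP², C)` with `C` *a* complex line (McDuff: "takes `C` … to a complex
line"; Wendl: "the sphere at infinity `ℂP¹ ⊂ ℂP²`", which for his embedding `ι₂` is the
coordinate line `{[z₁ : z₂ : 0]}`, LNM 2216 pp. 2–3); the vendored conclusion names the specific
coordinate line `L = {[v] | v₂ = 0}` of the tree's `ℂℙ² = Projectivization ℂ (Fin 3 → ℂ)`, and
its module docstring asserts that *the choice is immaterial, any projective line being carried to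
`L` by a projective linear, hence smooth, automorphism of `ℂℙ²`*. This file PROVES that assertion
over the tree's real-analytic `ℂℙⁿ` (`Literature.Topology.FourManifolds.ComplexProjectiveSpace`,
affine charts `affineChart i`), which so far had no projective transformations:

* `PlusOneSpherePair.projectiveMap A` — for `A ∈ GL(n + 1, ℂ)` the projective transformation
  `[v] ↦ [A v]` of `ComplexProjectiveSpace n` (Mathlib's `Projectivization.map` read on the type
  synonym); it is `C^m` for every `m` (`contMDiff_projectiveMap`: in the affine charts `j ↦ c` it
  is the rational map `w ↦ ((A ŵ)_{c'} / (A ŵ)_c)_{c' ≠ c}`, `ŵ = homogenize j w`, analytic where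
  `(A ŵ)_c ≠ 0`), and with its inverse `[v] ↦ [A⁻¹ v]` it is the diffeomorphism
  `projectiveDiffeo m A` (at the literal model `𝓡 4` of `ℂℙ²`: `projectiveDiffeoPlane A`);
* `PlusOneSpherePair.image_projectiveMap_hyperplane` — it carries the hyperplane `{φ = 0}` of a
  linear form `φ` onto the hyperplane `{φ ∘ A⁻¹ = 0}`; since some `A ∈ GL(n + 1, ℂ)` has `i`-th
  row any prescribed non-zero form `φ` (`exists_linearEquiv_proj_comp`, by two elementary
  matrices), every hyperplane of `ℂℙ²` is carried by a diffeomorphism onto the coordinate line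
  `{[v] | v_i = 0} = {y | ¬ CoordNeZero i y}` (`exists_diffeomorph_image_hyperplane_eq`);
* `Literature.Geometry.Symplectic.mcduff_plusOneSphere_pairDiffeomorph_iff_exists_line` — hence
  the named fact is EQUIVALENT to its variant whose conclusion reads "`Φ '' range b` is *some*
  projective line `{[v] | φ v = 0}`, `φ ≠ 0`", i.e. to the smooth content of the printed
  statement with the line left unspecified, as McDuff prints it.

Hyperplanes are written without an auxiliary definition as `{y | ∀ v, mk v = y → φ v = 0}`
(well defined: `PlusOneSpherePair.forall_mk_eq_mk_imp_iff`).

What is NOT here: the discharge `mcduff_plusOneSphere_pairDiffeomorph_holds`. Its content is the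
printed theorem itself — moduli spaces of embedded pseudo-holomorphic spheres, automatic
transversality, Gromov compactness, positivity of intersections and the adjunction formula, the
Lefschetz pencil of Wendl's Thm. F = Thm. 6.1 and the identification (Prop. 3.27) of a pencil
with one base point and no singular fibre with `(ℂP², pencil of lines)` (Wendl 2018, proof of
Thm. 6.6, p. 127; McDuff 1990, Lemma 5.3 and (5.4), pp. 708–709) — none of which Mathlib or
`Literature/` has (SIZE XL).

## References

* D. McDuff, *The structure of rational and ruled symplectic 4-manifolds*, J. Amer. Math. Soc. 3
  (1990) 679–712, Thm. 1.4, Cor. 1.5 (i), Lemma 5.3, (5.4) [McDuff1990].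
* C. Wendl, *Holomorphic Curves in Low Dimensions*, LNM 2216 (2018), §1.1 (the sphere at
  infinity), §1.2 Thm. D, §6.2 Thm. 6.9, Prop. 3.27 [Wendl2018].
* P. Griffiths, J. Harris, *Principles of Algebraic Geometry* (1978), Ch. 0 §2 (affine charts of
  `ℙⁿ`; projective transformations) [GriffithsHarrisPrinciples1978].
-/

noncomputable section

open scoped Manifold ContDiff Topology
open Set Function Module
open Literature.Topology.FourManifolds Literature.Topology.FourManifolds.ComplexProjectiveSpace

namespace Literature.Geometry.Symplectic

namespace PlusOneSpherePair

variable {n : ℕ}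

/-- Local notation: `𝔼 k` is the model Euclidean space `EuclideanSpace ℝ (Fin k)`. -/
local notation "𝔼 " k:arg => EuclideanSpace ℝ (Fin k)

/-- Local notation: `𝕍 k` is the space `Fin k → ℂ` of homogeneous coordinates. -/
local notation "𝕍 " k:arg => (Fin k → ℂ)

/-! ### Hyperplanes `{[v] | φ v = 0}` -/

/-- "`φ` vanishes on every representative of `[v]`" is the condition `φ v = 0` (a linear form
vanishing at `v` vanishes on the line `ℂ v`). [folklore] -/
theorem forall_mk_eq_mk_imp_iff (φ : 𝕍 (n + 1) →ₗ[ℂ] ℂ) (v : {v : 𝕍 (n + 1) // v ≠ 0}) :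
    (∀ w : {w : 𝕍 (n + 1) // w ≠ 0}, mk w = mk v → φ w = 0) ↔ φ v = 0 := by
  refine ⟨fun h => h v rfl, fun h w hw => ?_⟩
  obtain ⟨a, ha⟩ := (mk_eq_mk_iff w v).1 hw
  rw [← ha, map_smul, h, smul_zero]

/-- The coordinate hyperplane `{[v] | v i = 0}`, i.e. the complement of the `i`-th affine chart
domain, is the hyperplane of the `i`-th coordinate form. [folklore] -/
theorem setOf_not_coordNeZero_eq (i : Fin (n + 1)) :
    {y : ComplexProjectiveSpace n | ¬ CoordNeZero i y} =
      {y | ∀ v : {v : 𝕍 (n + 1) // v ≠ 0}, mk v = y →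
        (LinearMap.proj i : 𝕍 (n + 1) →ₗ[ℂ] ℂ) v = 0} := by
  ext y
  induction y using ind with
  | h v =>
    simp only [mem_setOf_eq]
    rw [forall_mk_eq_mk_imp_iff, coordNeZero_mk, not_not, LinearMap.proj_apply]

/-! ### Elementary matrices: an automorphism of `ℂᵏ` with a prescribed row -/

/-- If the linear form `φ` on `ℂᵏ` does not vanish at the basis vector `eᵢ`, then
`v ↦ v + (φ v - vᵢ) eᵢ` ("replace the `i`-th coordinate by `φ`") is a linear automorphism of
`ℂᵏ` whose `i`-th coordinate is `φ`. [folklore] -/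
theorem exists_linearEquiv_proj_comp_of_ne {k : ℕ} (φ : 𝕍 k →ₗ[ℂ] ℂ) (i : Fin k)
    (hφ : φ (Pi.single i 1) ≠ 0) :
    ∃ A : 𝕍 k ≃ₗ[ℂ] 𝕍 k, (LinearMap.proj i : 𝕍 k →ₗ[ℂ] ℂ).comp (A : 𝕍 k →ₗ[ℂ] 𝕍 k) = φ := by
  let f : 𝕍 k →ₗ[ℂ] 𝕍 k :=
    LinearMap.id + (φ - LinearMap.proj i).smulRight (Pi.single i (1 : ℂ))
  have hf : ∀ v, f v = v + (φ v - v i) • Pi.single i (1 : ℂ) := fun v => rfl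
  have hfi : ∀ v, f v i = φ v := fun v => by simp [hf]
  have hinj : Injective f := by
    refine (injective_iff_map_eq_zero f).2 fun u hu => ?_
    have h1 : φ u = 0 := by rw [← hfi u, hu, Pi.zero_apply]
    have h2 : u = u i • Pi.single i (1 : ℂ) := by
      have h := eq_neg_of_add_eq_zero_left ((hf u).symm.trans hu)
      rw [h1, zero_sub, neg_smul, neg_neg] at h
      exact h
    have h3 : u i = 0 := by
      have h := congrArg φ h2
      rw [h1, map_smul, smul_eq_mul] at h
      exact (mul_eq_zero.1 h.symm).resolve_right hφ
    rw [h2, h3, zero_smul]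
  refine ⟨LinearEquiv.ofInjectiveEndo f hinj, LinearMap.ext fun v => ?_⟩
  rw [LinearMap.comp_apply, LinearMap.proj_apply, LinearEquiv.coe_coe,
    LinearEquiv.coe_ofInjectiveEndo, hfi]

/-- **`GL(k, ℂ)` is transitive on non-zero linear forms**: every non-zero linear form `φ` on
`ℂᵏ` is the `i`-th coordinate of some linear automorphism `A`, i.e. `φ = e_i^* ∘ A`
(if `φ eᵢ = 0`, precompose the previous construction with the transvection `v ↦ v + vᵢ eⱼ`
for some `j` with `φ eⱼ ≠ 0`). [folklore] -/
theorem exists_linearEquiv_proj_comp {k : ℕ} (φ : 𝕍 k →ₗ[ℂ] ℂ) (hφ : φ ≠ 0) (i : Fin k) :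
    ∃ A : 𝕍 k ≃ₗ[ℂ] 𝕍 k, (LinearMap.proj i : 𝕍 k →ₗ[ℂ] ℂ).comp (A : 𝕍 k →ₗ[ℂ] 𝕍 k) = φ := by
  by_cases hi : φ (Pi.single i 1) ≠ 0
  · exact exists_linearEquiv_proj_comp_of_ne φ i hi
  rw [not_not] at hi
  obtain ⟨j, hj⟩ : ∃ j, φ (Pi.single j 1) ≠ 0 := by
    by_contra h
    simp only [not_exists, not_not] at h
    refine hφ (LinearMap.pi_ext' fun j => LinearMap.ext_ring ?_)
    simp [h j]
  have hij : i ≠ j := by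
    rintro rfl
    exact hj hi
  have hji : (Pi.single j (1 : ℂ) : 𝕍 k) i = 0 := by simp [hij]
  -- the transvection `T v = v + vᵢ eⱼ` and its inverse `v ↦ v - vᵢ eⱼ`
  let T : 𝕍 k ≃ₗ[ℂ] 𝕍 k :=
    { toFun := fun v => v + v i • Pi.single j (1 : ℂ)
      invFun := fun v => v - v i • Pi.single j (1 : ℂ)
      map_add' := fun v w => by
        simp only [Pi.add_apply, add_smul]
        abel
      map_smul' := fun c v => by
        simp only [Pi.smul_apply, smul_eq_mul, RingHom.id_apply, smul_add, smul_smul]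
      left_inv := fun v => by
        simp only [Pi.add_apply, Pi.smul_apply, hji, smul_eq_mul, mul_zero, add_zero,
          add_sub_cancel_right]
      right_inv := fun v => by
        simp only [Pi.sub_apply, Pi.smul_apply, hji, smul_eq_mul, mul_zero, sub_zero,
          sub_add_cancel] }
  have hT : ∀ v, T v = v + v i • Pi.single j (1 : ℂ) := fun v => rfl
  have hψ : (φ.comp (T : 𝕍 k →ₗ[ℂ] 𝕍 k)) (Pi.single i 1) ≠ 0 := by
    rw [LinearMap.comp_apply, LinearEquiv.coe_coe, hT, Pi.single_eq_same, one_smul, map_add, hi,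
      zero_add]
    exact hj
  obtain ⟨B, hB⟩ := exists_linearEquiv_proj_comp_of_ne (φ.comp (T : 𝕍 k →ₗ[ℂ] 𝕍 k)) i hψ
  refine ⟨T.symm.trans B, LinearMap.ext fun v => ?_⟩
  have h := LinearMap.congr_fun hB (T.symm v)
  rw [LinearMap.comp_apply, LinearMap.comp_apply, LinearEquiv.coe_coe, LinearEquiv.coe_coe,
    LinearEquiv.apply_symm_apply] at h
  rw [LinearMap.comp_apply, LinearEquiv.coe_coe, LinearEquiv.trans_apply]
  exact h

/-! ### Projective transformations `[v] ↦ [A v]` -/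

section ProjectiveMap

variable (A : 𝕍 (n + 1) ≃ₗ[ℂ] 𝕍 (n + 1))

/-- The **projective transformation** `[v] ↦ [A v]` of `ℂℙⁿ` induced by a linear automorphism
`A` of `ℂⁿ⁺¹` (Mathlib's `Projectivization.map`, read on the type synonym
`ComplexProjectiveSpace n`; Griffiths–Harris, Ch. 0 §2). [folklore] -/
def projectiveMap : ComplexProjectiveSpace n → ComplexProjectiveSpace n := fun y =>
  Projectivization.map (A : 𝕍 (n + 1) →ₗ[ℂ] 𝕍 (n + 1)) A.injective y

/-- On classes: `projectiveMap A [v] = [A v]`. [folklore] -/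
@[simp]
theorem projectiveMap_mk (v : {v : 𝕍 (n + 1) // v ≠ 0}) :
    projectiveMap A (mk v) = mk ⟨A v, A.map_ne_zero_iff.2 v.2⟩ :=
  rfl

/-- `[v] ↦ [A⁻¹ v]` is a left inverse of `[v] ↦ [A v]`. [folklore] -/
@[simp]
theorem projectiveMap_symm_apply (y : ComplexProjectiveSpace n) :
    projectiveMap A.symm (projectiveMap A y) = y := by
  induction y using ind with
  | h v =>
    rw [projectiveMap_mk, projectiveMap_mk]
    congr 1
    exact Subtype.ext (A.symm_apply_apply _)

/-- `[v] ↦ [A⁻¹ v]` is a right inverse of `[v] ↦ [A v]`. [folklore] -/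
@[simp]
theorem projectiveMap_apply_symm (y : ComplexProjectiveSpace n) :
    projectiveMap A (projectiveMap A.symm y) = y := by
  simpa only [LinearEquiv.symm_symm] using projectiveMap_symm_apply A.symm y

/-- `[v] ↦ [A v]` is continuous (it descends the continuous linear map `A` along the quotient
map `mk`). [folklore] -/
theorem continuous_projectiveMap : Continuous (projectiveMap A) := by
  rw [isQuotientMap_mk.continuous_iff]
  have hA : Continuous fun v : {v : 𝕍 (n + 1) // v ≠ 0} =>
      (⟨A v, A.map_ne_zero_iff.2 v.2⟩ : {v : 𝕍 (n + 1) // v ≠ 0}) :=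
    ((A : 𝕍 (n + 1) →ₗ[ℂ] 𝕍 (n + 1)).continuous_of_finiteDimensional.comp
      continuous_subtype_val).subtype_mk _
  exact continuous_mk.comp hA

/-- The image of the hyperplane `{φ = 0}` under `[v] ↦ [A v]` is the hyperplane `{φ ∘ A⁻¹ = 0}`.
[folklore] -/
theorem image_projectiveMap_hyperplane (φ : 𝕍 (n + 1) →ₗ[ℂ] ℂ) :
    projectiveMap A '' {y | ∀ v : {v : 𝕍 (n + 1) // v ≠ 0}, mk v = y → φ v = 0} =
      {y | ∀ v : {v : 𝕍 (n + 1) // v ≠ 0}, mk v = y →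
        (φ.comp (A.symm : 𝕍 (n + 1) →ₗ[ℂ] 𝕍 (n + 1))) v = 0} := by
  ext y
  induction y using ind with
  | h v =>
    rw [mem_image, mem_setOf_eq, forall_mk_eq_mk_imp_iff, LinearMap.comp_apply,
      LinearEquiv.coe_coe]
    constructor
    · rintro ⟨x, hx, hxy⟩
      induction x using ind with
      | h u =>
        rw [mem_setOf_eq, forall_mk_eq_mk_imp_iff] at hx
        rw [projectiveMap_mk] at hxy
        obtain ⟨a, ha⟩ := (mk_eq_mk_iff _ _).1 hxy.symm
        have hv : (v : 𝕍 (n + 1)) = a • A u := ha.symm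
        rw [hv, map_smul, A.symm_apply_apply, map_smul, hx, smul_zero]
    · intro hv
      refine ⟨mk ⟨A.symm v, A.symm.map_ne_zero_iff.2 v.2⟩, ?_, ?_⟩
      · rw [mem_setOf_eq, forall_mk_eq_mk_imp_iff]
        exact hv
      · rw [projectiveMap_mk]
        congr 1
        exact Subtype.ext (A.apply_symm_apply _)

/-! ### Smoothness of `[v] ↦ [A v]` -/

/-- The preferred chart followed by its inverse fixes the base point:
`[homogenize j (chart_j x₀)] = x₀`, `j = chartIndex x₀` (the extended chart at `x₀` is
`realCoordinates ∘ affineCoordComplex j` with inverse `w ↦ [homogenize j (realCoordinates⁻¹ w)]`,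
both definitionally, cf. `Literature.Geometry.Kaehler.CPn.extChartAt_apply`). [folklore] -/
theorem mk_homogenize_extChartAt_self (x₀ : ComplexProjectiveSpace n) :
    mk (homogenize (chartIndex x₀) ((realCoordinates n).symm (extChartAt (𝓡 (2 * n)) x₀ x₀))) =
      x₀ :=
  (affineChart (chartIndex x₀)).left_inv (coordNeZero_chartIndex x₀)

/-- Each coordinate `u ↦ (A u)_k` is complex-analytic (it is `ℂ`-linear). [folklore] -/
theorem contDiff_apply_linearEquiv (k : Fin (n + 1)) :
    ContDiff ℂ ω fun u : 𝕍 (n + 1) => A u k :=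
  (contDiff_apply ℂ ℂ k).comp A.toContinuousLinearEquiv.contDiff

/-- The affine-coordinate expression `u ↦ ((A u)_{c.succAbove i} / (A u)_c)_i` of `[v] ↦ [A v]`
in the target chart `c` is complex-analytic where `(A u)_c ≠ 0`. [folklore] -/
theorem contDiffOn_projectiveMap_expr (c : Fin (n + 1)) :
    ContDiffOn ℂ ω (fun u : 𝕍 (n + 1) => fun i : Fin n => A u (c.succAbove i) / A u c)
      {u | A u c ≠ 0} :=
  contDiffOn_pi' fun i => (contDiff_apply_linearEquiv A (c.succAbove i)).contDiffOn.div
    (contDiff_apply_linearEquiv A c).contDiffOn fun _ h => h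

/-- **Projective transformations are smooth**: `[v] ↦ [A v]` is `C^m` on `ℂℙⁿ` for every `m`
(in the charts `j ↦ c` it is the realification of the rational map
`w ↦ ((A ŵ)_{c'} / (A ŵ)_c)`, `ŵ = homogenize j w`; Griffiths–Harris, Ch. 0 §2). [folklore] -/
theorem contMDiff_projectiveMap {m : ℕ∞ω} :
    ContMDiff (𝓡 (2 * n)) (𝓡 (2 * n)) m (projectiveMap A) := by
  intro p
  rw [contMDiffAt_iff]
  refine ⟨(continuous_projectiveMap A).continuousAt, ?_⟩
  set j : Fin (n + 1) := chartIndex p with hj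
  set c : Fin (n + 1) := chartIndex (projectiveMap A p) with hc
  -- the composite in the charts `j` (source) and `c` (target)
  have hcomp : (extChartAt (𝓡 (2 * n)) (projectiveMap A p)) ∘ projectiveMap A ∘
      (extChartAt (𝓡 (2 * n)) p).symm =
      (realCoordinates n) ∘ (fun u : 𝕍 (n + 1) => fun i : Fin n => A u (c.succAbove i) / A u c) ∘
        fun w : 𝔼 (2 * n) =>
          ((homogenize j ((realCoordinates n).symm w) : {v : 𝕍 (n + 1) // v ≠ 0}) :
            𝕍 (n + 1)) := by
    funext w
    rfl
  rw [hcomp]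
  simp only [modelWithCornersSelf_coe, range_id, contDiffWithinAt_univ]
  -- the base point lies in the domain of analyticity
  have hne : A ((homogenize j ((realCoordinates n).symm (extChartAt (𝓡 (2 * n)) p p)) :
      {v : 𝕍 (n + 1) // v ≠ 0}) : 𝕍 (n + 1)) c ≠ 0 := by
    have h : CoordNeZero c (projectiveMap A p) := coordNeZero_chartIndex _
    rw [← mk_homogenize_extChartAt_self p, projectiveMap_mk, coordNeZero_mk] at h
    exact h
  have hopen : IsOpen {u : 𝕍 (n + 1) | A u c ≠ 0} :=
    isOpen_ne.preimage (contDiff_apply_linearEquiv A c).continuous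
  have hg : ContDiffAt ℝ m (fun u : 𝕍 (n + 1) => fun i : Fin n => A u (c.succAbove i) / A u c)
      ((homogenize j ((realCoordinates n).symm (extChartAt (𝓡 (2 * n)) p p)) :
        {v : 𝕍 (n + 1) // v ≠ 0}) : 𝕍 (n + 1)) :=
    (((contDiffOn_projectiveMap_expr A c).of_le le_top).restrict_scalars ℝ).contDiffAt
      (hopen.mem_nhds hne)
  have hH : ContDiffAt ℝ m (fun w : 𝔼 (2 * n) =>
      ((homogenize j ((realCoordinates n).symm w) : {v : 𝕍 (n + 1) // v ≠ 0}) : 𝕍 (n + 1)))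
      (extChartAt (𝓡 (2 * n)) p p) :=
    (contDiff_coe_homogenize_realCoordinates_symm j).contDiffAt
  exact (realCoordinates n).contDiff.contDiffAt.comp _ (hg.comp (extChartAt (𝓡 (2 * n)) p p) hH)

/-- **The projective transformation `[v] ↦ [A v]` as a diffeomorphism of `ℂℙⁿ`** (inverse
`[v] ↦ [A⁻¹ v]`), of class `C^m` for any `m`. [folklore] -/
def projectiveDiffeo (m : ℕ∞ω) :
    ComplexProjectiveSpace n ≃ₘ^m⟮𝓡 (2 * n), 𝓡 (2 * n)⟯ ComplexProjectiveSpace n where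
  toFun := projectiveMap A
  invFun := projectiveMap A.symm
  left_inv := projectiveMap_symm_apply A
  right_inv := projectiveMap_apply_symm A
  contMDiff_toFun := contMDiff_projectiveMap A
  contMDiff_invFun := contMDiff_projectiveMap A.symm

/-- `projectiveDiffeo m A` is the map `projectiveMap A`. [folklore] -/
@[simp]
theorem coe_projectiveDiffeo (m : ℕ∞ω) :
    (projectiveDiffeo A m : ComplexProjectiveSpace n → ComplexProjectiveSpace n) =
      projectiveMap A :=
  rfl

end ProjectiveMap

/-! ### The complex projective plane at the literal model `𝓡 4` -/

/-- The projective transformation `[v] ↦ [A v]` of `ℂℙ²` as a `C^∞` diffeomorphism for the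
literal model `𝓡 4` of `Literature.Topology.FourManifolds.ComplexProjectivePlane` (the instances of
`ℂℙ²` at `EuclideanSpace ℝ (Fin 4)` are re-exports of those of `ComplexProjectiveSpace 2`).
[folklore] -/
def projectiveDiffeoPlane (A : 𝕍 3 ≃ₗ[ℂ] 𝕍 3) :
    ComplexProjectivePlane ≃ₘ⟮𝓡 4, 𝓡 4⟯ ComplexProjectivePlane :=
  projectiveDiffeo (n := 2) A ∞

/-- `projectiveDiffeoPlane A` is the map `projectiveMap A`. [folklore] -/
@[simp]
theorem coe_projectiveDiffeoPlane (A : 𝕍 3 ≃ₗ[ℂ] 𝕍 3) :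
    (projectiveDiffeoPlane A : ComplexProjectivePlane → ComplexProjectivePlane) =
      projectiveMap (n := 2) A :=
  rfl

/-- **Every projective line of `ℂℙ²` is carried onto the coordinate line `{[v] | v_i = 0}` by a
diffeomorphism of `ℂℙ²`** (a projective transformation; Griffiths–Harris, Ch. 0 §2).
[folklore] -/
theorem exists_diffeomorph_image_hyperplane_eq (φ : 𝕍 3 →ₗ[ℂ] ℂ) (hφ : φ ≠ 0) (i : Fin 3) :
    ∃ Ψ : ComplexProjectivePlane ≃ₘ⟮𝓡 4, 𝓡 4⟯ ComplexProjectivePlane,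
      Ψ '' {y | ∀ v : {v : 𝕍 3 // v ≠ 0}, mk (n := 2) v = y → φ v = 0} =
        {y | ¬ CoordNeZero (n := 2) i y} := by
  obtain ⟨A, hA⟩ := exists_linearEquiv_proj_comp φ hφ i
  refine ⟨projectiveDiffeoPlane A, ?_⟩
  have h2 : φ.comp (A.symm : 𝕍 3 →ₗ[ℂ] 𝕍 3) = LinearMap.proj i := by
    rw [← hA, LinearMap.comp_assoc]
    refine LinearMap.ext fun v => ?_
    rw [LinearMap.comp_apply, LinearMap.comp_apply, LinearEquiv.coe_coe, LinearEquiv.coe_coe,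
      LinearEquiv.apply_symm_apply]
  rw [coe_projectiveDiffeoPlane, image_projectiveMap_hyperplane, h2, setOf_not_coordNeZero_eq]

end PlusOneSpherePair

open PlusOneSpherePair in
/-- **The choice of line in `mcduff_plusOneSphere_pairDiffeomorph` is immaterial.** The named
fact (conclusion: a diffeomorphism `Φ : N ≃ₘ ℂℙ²` with `Φ '' range b` the coordinate line
`{[v] | v₂ = 0}`) is equivalent to its variant with conclusion "`Φ '' range b` is *some*
projective line `{[v] | φ v = 0}`, `φ` a non-zero linear form on `ℂ³`" — the smooth content of
the printed statement ("this symplectomorphism may be chosen so that it takes `C` … to a complex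
line", McDuff 1990, Thm. 1.4; "`S` is identified with the sphere at infinity", Wendl 2018,
Thm. 6.9 (2)): compose with a projective transformation carrying that line to `{v₂ = 0}`
(`PlusOneSpherePair.exists_diffeomorph_image_hyperplane_eq`).
[cite: McDuff1990, Thm. 1.4 + Cor. 1.5 (i), p. 682] -/
theorem mcduff_plusOneSphere_pairDiffeomorph_iff_exists_line :
    mcduff_plusOneSphere_pairDiffeomorph ↔
    ∀ (N : Type) [TopologicalSpace N] [T2Space N] [SecondCountableTopology N] [CompactSpace N]
      [ConnectedSpace N] [ChartedSpace (EuclideanSpace ℝ (Fin 4)) N] [IsManifold (𝓡 4) ∞ N]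
      (s : Literature.Geometry.Kaehler.MForm (𝓡 4) N ℝ 2) (S : Type) [TopologicalSpace S]
      [CompactSpace S] [ConnectedSpace S] [ChartedSpace (EuclideanSpace ℝ (Fin 2)) S]
      [IsManifold (𝓡 2) ∞ S] (b : S → N),
      Literature.Geometry.Kaehler.IsSmoothForm s → Literature.Geometry.Kaehler.IsClosedForm s →
      (∀ x (v : TangentSpace (𝓡 4) x), v ≠ 0 → ∃ w, s x ![v, w] ≠ 0) →
      Manifold.IsSmoothEmbedding (𝓡 2) (𝓡 4) ∞ b →
      (∀ y (v : TangentSpace (𝓡 2) y), v ≠ 0 → ∃ w : TangentSpace (𝓡 2) y,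
        s (b y) ![mfderiv (𝓡 2) (𝓡 4) b y v, mfderiv (𝓡 2) (𝓡 4) b y w] ≠ 0) →
      Nonempty (S ≃ₘ⟮𝓡 2, 𝓡 2⟯ Metric.sphere (0 : EuclideanSpace ℝ (Fin 3)) 1) →
      Module.finrank ℤ (Literature.Topology.FourManifolds.singularHomologyZ N 2) = 1 →
      Subsingleton (Literature.Topology.FourManifolds.singularHomologyZ (↥((Set.range b)ᶜ)) 1) →
      ∃ Φ : N ≃ₘ⟮𝓡 4, 𝓡 4⟯ ComplexProjectivePlane, ∃ φ : (Fin 3 → ℂ) →ₗ[ℂ] ℂ, φ ≠ 0 ∧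
        Φ '' (Set.range b) = {y | ∀ v : {v : Fin 3 → ℂ // v ≠ 0}, mk (n := 2) v = y → φ v = 0} := by
  constructor
  · intro h N _ _ _ _ _ _ _ s S _ _ _ _ _ b hs hcl hnd hb hbs hS h2 h1
    obtain ⟨Φ, hΦ⟩ := h N s S b hs hcl hnd hb hbs hS h2 h1
    refine ⟨Φ, LinearMap.proj 2, fun h0 => ?_, ?_⟩
    · have := LinearMap.congr_fun h0 (Pi.single 2 1)
      simp at this
    · rw [hΦ, setOf_not_coordNeZero_eq]
  · intro h N _ _ _ _ _ _ _ s S _ _ _ _ _ b hs hcl hnd hb hbs hS h2 h1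
    obtain ⟨Φ, φ, hφ, hΦ⟩ := h N s S b hs hcl hnd hb hbs hS h2 h1
    obtain ⟨Ψ, hΨ⟩ := exists_diffeomorph_image_hyperplane_eq φ hφ 2
    refine ⟨Φ.trans Ψ, ?_⟩
    rw [Diffeomorph.coe_trans, Set.image_comp, hΦ, hΨ]

end Literature.Geometry.Symplectic
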